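import Summits.KontsevichZagierPeriods.KontsevichZagierPeriods.Theorems.UnfoldedStokesStokesGenerationStubSpanToRepsAuxC1
import Summits.KontsevichZagierPeriods.KontsevichZagierPeriods.Theorems.UnfoldedStokesStokesGenerationStubSpanToRepsAuxSemialg
import Summits.KontsevichZagierPeriods.KontsevichZagierPeriods.Theorems.UnfoldedStokesStokesGenerationStubSpanToRepsAuxCoeff
import Summits.KontsevichZagierPeriods.KontsevichZagierPeriods.Theorems.UnfoldedStokesStokesGenerationStubSpanToRepsAuxSeries
import Summits.KontsevichZagierPeriods.KontsevichZagierPeriods.Theorems.UnfoldedStokesStokesGenerationStubSpanToRepsAuxAlg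
import Literature.NumberTheory.Transcendental.KZCubicalCalculus
import Mathlib.Analysis.Normed.Operator.BoundedLinearMaps

/-!
# `StokesGeneration` (stmt-KontsevichZagierPeriods-3586), line `Sketch`: stub `stub_spanToReps`

The FOLDING HALF OF THE DICTIONARY between Ayoub's algebra `𝒪_{ℚ̄-alg}(𝔻̄^∞)` (J. Ayoub, EMS Newsl.
91 (2014), §2.2, Def. 9–10, Rem. 13; Ann. of Math. 181 (2015), §1.1, Conj. 1.1) and real type-(a)
integrands of the Kontsevich–Zagier calculus, typed over
`Literature/NumberTheory/Transcendental/AyoubPeriodSeries.lean`. If the complex series `F` of the real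
germ `Σₐ cₐ xᵃ` (sum `h` on the closed cube `[0,1]ᴺ`) is a `ℚ̄`-combination `Σⱼ λⱼ (∂Gⱼ/∂z_{iⱼ} −
Gⱼ|_{z_{iⱼ}=1} + Gⱼ|_{z_{iⱼ}=0})` with `Gⱼ ∈ 𝒪_{ℚ̄-alg}(𝔻̄^∞)`, then on the closed cube `[0,1]ᴹ` of a
suitable dimension `M ≥ N` the pulled-back germ `h ∘ pr` is `Σⱼ (∂gⱼ/∂x_{iⱼ} − gⱼ|_{x_{iⱼ}=1} +
gⱼ|_{x_{iⱼ}=0})` for functions `gⱼ` of class `C¹` and `ℚ`-semialgebraic on an open box containing the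
cube, each term carried by a closed-cube representation.

Proof (assembled from the five support files `…StubSpanToRepsAux{C1,Semialg,Coeff,Series,Alg}`):
`Kⱼ = λⱼ Gⱼ ∈ 𝒪_{ℚ̄-alg}(𝔻̄^∞)` (`AyoubRel.smul_mem_Oan`) and `F = Σⱼ relAC iⱼ Kⱼ` (`AyoubRel.relAC_smul`);
`M` exceeds `N`, the `iⱼ`, the variables of the `Kⱼ` and those of rational polynomials `Pⱼ ∈ ℚ[z][Y]`
with `Pⱼ(Kⱼ) = 0` (descent from `ℚ̄(z)` to `ℚ(z)`, part Alg); `gⱼ(x) = Σₐ re(κⱼ a) xᵃ` with `κⱼ` the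
coefficients of `Kⱼ` re-indexed by `Fin M →₀ ℕ` is `C¹` on the box `(-ρⱼ, ρⱼ)ᴹ`, `1 < ρⱼ < rⱼ` rational
below the polyradius, with termwise partials (part C1); it is the real part of `kⱼ(x) = Σₐ κⱼ(a) xᵃ`,
which satisfies `Σₙ qₙ(x) kⱼ(x)ⁿ = 0` there (part Alg), hence is `ℚ`-semialgebraic (part Semialg); on
the closed unit cube `h(pr x) = re Σ_b F_b pt(x)ᵇ = Σⱼ re [∂ᵢKⱼ − Kⱼ|₁ + Kⱼ|₀](pt x) =
Σⱼ (∂gⱼ/∂x_{iⱼ}(x) − gⱼ(x|₁) + gⱼ(x|₀))` (parts Coeff and Series). The representations are the closed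
cube with these continuous `ℚ`-semialgebraic integrands (partial derivatives of semialgebraic functions
are semialgebraic, `IsSemialgebraicFunOn.fderiv_apply_single`). No definition is introduced.
-/

noncomputable section

-- `Summit.KontsevichZagierPeriods.KontsevichZagierPeriods.…` is the tree's mandated layout (single-conjunct summit).
set_option linter.dupNamespace false

namespace Summit.KontsevichZagierPeriods.KontsevichZagierPeriods.StokesGenerationLine

open MeasureTheory Set MvPolynomial
open Literature.ModelTheory.ExponentialFields (IsSemialgebraic isSemialgebraic_setOf_eval_pos)
open Literature.NumberTheory.Transcendental
open Literature.NumberTheory.Transcendental.KZ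
open Literature.NumberTheory.Transcendental.AyoubRel

/-! ## The open box `(-ρ, ρ)ᴹ` -/

section Box

variable {M : ℕ}

/-- The open box `(-ρ, ρ)ᴹ`, `ρ ∈ ℚ`, is `ℚ`-semialgebraic. [folklore] -/
theorem isSemialgebraic_box (ρ : ℚ) :
    IsSemialgebraic ℚ (Set.pi Set.univ (fun _ : Fin M => Set.Ioo (-(ρ : ℝ)) ρ)) := by
  have h : Set.pi Set.univ (fun _ : Fin M => Set.Ioo (-(ρ : ℝ)) ρ) =
      ⋂ l ∈ (Finset.univ : Finset (Fin M)),
        ({x : Fin M → ℝ | 0 < aeval x (X l + C ρ : MvPolynomial (Fin M) ℚ)} ∩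
          {x | 0 < aeval x (C ρ - X l : MvPolynomial (Fin M) ℚ)}) := by
    ext x
    simp only [mem_pi, mem_univ, true_implies, mem_Ioo, mem_iInter, mem_inter_iff, Finset.mem_univ,
      mem_setOf_eq, map_add, map_sub, aeval_X, aeval_C, eq_ratCast]
    exact forall_congr' fun l => by constructor <;> rintro ⟨h1, h2⟩ <;> constructor <;> linarith
  rw [h]
  exact IsSemialgebraic.biInter _ _ fun l _ =>
    (isSemialgebraic_setOf_eval_pos _).inter (isSemialgebraic_setOf_eval_pos _)

/-- The closed unit cube lies in the open box `(-ρ, ρ)ᴹ` for `ρ > 1`. [folklore] -/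
theorem cubePi_subset_box {ρ : ℝ} (hρ : 1 < ρ) :
    Set.pi Set.univ (fun _ : Fin M => Set.Icc (0:ℝ) 1) ⊆
      Set.pi Set.univ (fun _ : Fin M => Set.Ioo (-ρ) ρ) :=
  Set.pi_mono fun _ _ => Set.Icc_subset_Ioo (by linarith) hρ

/-- The closed unit cube `Set.pi univ (fun _ => Icc 0 1)` is `ℚ`-semialgebraic. [folklore] -/
theorem isSemialgebraic_cubePi (M : ℕ) :
    IsSemialgebraic ℚ (Set.pi Set.univ (fun _ : Fin M => Set.Icc (0:ℝ) 1)) := by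
  rw [← cube_eq_pi]
  exact isSemialgebraic_cube

/-- Setting one coordinate to a rational constant is a `ℚ`-semialgebraic (polynomial) self-map of
the closed unit cube. [cite: BochnakCosteRoy1998, Prop. 2.2.6] -/
theorem isSemialgebraicMapOn_update (l : Fin M) (c : ℚ) :
    IsSemialgebraicMapOn ℚ (Set.pi Set.univ (fun _ : Fin M => Set.Icc (0:ℝ) 1))
      (fun x => Function.update x l (c : ℝ)) := by
  classical
  refine (isSemialgebraicMapOn_aeval (isSemialgebraic_cubePi M)
    (Function.update (fun j : Fin M => (X j : MvPolynomial (Fin M) ℚ)) l (C c))).congr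
    fun x _ => ?_
  funext j
  rcases eq_or_ne j l with rfl | hj
  · simp
  · simp [Function.update_of_ne hj]

end Box

/-! ## One generator: the real function `g = re k` on its box -/

section Generator

variable {M : ℕ}

/-- The complex family `κ(a) xᵃ` is absolutely summable on the closed box of radius `r` when
`Σₐ ‖κ a‖ r^{|a|} < ∞`. [folklore] -/
theorem summable_mul_ofReal_monomial {κ : (Fin M →₀ ℕ) → ℂ} {r : ℝ}
    (hκ : Summable fun a => ‖κ a‖ * r ^ a.degree) {x : Fin M → ℝ} (hx : ∀ l, |x l| ≤ r) :
    Summable fun a : Fin M →₀ ℕ => κ a * ((∏ l, x l ^ a l : ℝ) : ℂ) := by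
  refine Summable.of_norm_bounded hκ fun a => ?_
  rw [norm_mul, Complex.norm_real, Real.norm_eq_abs]
  exact mul_le_mul_of_nonneg_left (abs_monomial_le a hx) (norm_nonneg _)

/-- **One generator.** For `K ∈ ℂ[[z₀, z₁, …]]` in the variables `z₀, …, z_{M-1}` with
`Σ_b ‖K_b‖ r^{|b|} < ∞`, `r > 1`, root of a non-zero `P ∈ ℚ[z][Y]` whose coefficients involve only
these variables: for a rational `1 < ρ < r`, the real function `g(x) = Σₐ re(κ a) xᵃ` (`κ` = the
coefficients of `K` re-indexed by `Fin M →₀ ℕ`) is `ℚ`-semialgebraic and `C¹` on the open box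
`(-ρ, ρ)ᴹ`, with termwise partial derivatives. [cite: Ayoub2014, Def. 9–10 and Rem. 13] -/
theorem generator_package {K : CSeries} {r : ℝ} (hr : 1 < r)
    (hKs : Summable fun b : ℕ →₀ ℕ => ‖MvPowerSeries.coeff b K‖ * r ^ Finsupp.degree b)
    (hKd : DependsOnlyOnLT K M) {P : Polynomial (MvPolynomial ℕ ℚ)} (hP0 : P ≠ 0)
    (hP : Polynomial.eval₂ (polyToCSeries (algebraMap ℚ ℂ)) K P = 0)
    (hvars : ∀ n, (↑(P.coeff n).vars : Set ℕ) ⊆ Set.range (Fin.val : Fin M → ℕ)) :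
    ∃ ρ : ℚ, 1 < (ρ : ℝ) ∧ (ρ : ℝ) < r ∧
      IsSemialgebraicFunOn ℚ (Set.pi Set.univ (fun _ : Fin M => Set.Ioo (-(ρ : ℝ)) ρ))
        (fun y => ∑' a : Fin M →₀ ℕ,
          (MvPowerSeries.coeff (Finsupp.embDomain Fin.valEmbedding a) K).re * ∏ l, y l ^ a l) ∧
      ContDiffOn ℝ 1
        (fun y => ∑' a : Fin M →₀ ℕ,
          (MvPowerSeries.coeff (Finsupp.embDomain Fin.valEmbedding a) K).re * ∏ l, y l ^ a l)
        (Set.pi Set.univ (fun _ : Fin M => Set.Ioo (-(ρ : ℝ)) ρ)) ∧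
      ∀ x ∈ Set.pi Set.univ (fun _ : Fin M => Set.Ioo (-(ρ : ℝ)) ρ), ∀ l : Fin M,
        fderiv ℝ (fun y => ∑' a : Fin M →₀ ℕ,
          (MvPowerSeries.coeff (Finsupp.embDomain Fin.valEmbedding a) K).re * ∏ l, y l ^ a l) x
            (Pi.single l 1) =
          ∑' a : Fin M →₀ ℕ, (MvPowerSeries.coeff (Finsupp.embDomain Fin.valEmbedding a) K).re *
            ((∏ l' ∈ Finset.univ.erase l, x l' ^ a l') * ((a l : ℝ) * x l ^ (a l - 1))) := by
  obtain ⟨ρ, h1ρ, hρr⟩ := exists_rat_btwn hr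
  have hκw := summable_weighted_fin (M := M) hKs
  have hγ : Summable fun a : Fin M →₀ ℕ =>
      |(MvPowerSeries.coeff (Finsupp.embDomain Fin.valEmbedding a) K).re| * r ^ a.degree :=
    summable_abs_re_weighted (fun a => pow_nonneg (zero_le_one.trans hr.le) _) hκw
  have hC1 := contDiffOn_tsum_monomial
    (fun a => (MvPowerSeries.coeff (Finsupp.embDomain Fin.valEmbedding a) K).re) h1ρ.le hρr hγ
  refine ⟨ρ, h1ρ, hρr, ?_, hC1, fun x hx l => fderiv_tsum_monomial_apply_single
    (fun a => (MvPowerSeries.coeff (Finsupp.embDomain Fin.valEmbedding a) K).re) h1ρ.le hρr hγ hx l⟩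
  -- the polynomial identity and semialgebraicity
  obtain ⟨Q, hQ0, hid⟩ := exists_polynomial_identity_fin (zero_lt_one.trans hr) hKs hKd P hP0 hP hvars
  have hbox : ∀ x ∈ Set.pi Set.univ (fun _ : Fin M => Set.Ioo (-(ρ : ℝ)) ρ), ∀ l, |x l| ≤ r :=
    fun x hx l => (abs_le_of_mem_box hx l).trans hρr.le
  refine isSemialgebraicFunOn_re_of_polynomial_identity (isOpen_box _) (isSemialgebraic_box ρ)
    hC1.continuousOn
    (k := fun x => ∑' a : Fin M →₀ ℕ,
      MvPowerSeries.coeff (Finsupp.embDomain Fin.valEmbedding a) K * ((∏ l, x l ^ a l : ℝ) : ℂ))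
    (fun x hx => re_tsum_mul_ofReal (summable_mul_ofReal_monomial hκw (hbox x hx))) Q hQ0
    fun x hx => ?_
  have heq : (∑' a : Fin M →₀ ℕ, MvPowerSeries.coeff (Finsupp.embDomain Fin.valEmbedding a) K *
      ((∏ l, x l ^ a l : ℝ) : ℂ)) = ∑' a : Fin M →₀ ℕ,
        MvPowerSeries.coeff (Finsupp.embDomain Fin.valEmbedding a) K * ∏ j, ((x j : ℝ) : ℂ) ^ (a j) :=
    tsum_congr fun a => by push_cast; rfl
  rw [heq]
  exact hid x (hbox x hx)

end Generator

/-! ## The identity on the closed unit cube -/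

section Identity

variable {M : ℕ}

/-- **The real part of the evaluated type-(a) image** `re [∂_lK − K|_{z_l=1} + K|_{z_l=0}](pt x)` at a
point `x` of the closed unit cube is `∂_l g(x) − g(x|_{x_l=1}) + g(x|_{x_l=0})` termwise, `g = Σ re κ xᵃ`.
[cite: Ayoub2014, Def. 10 and Rem. 13] -/
theorem re_tsum_coeff_relAC {K : CSeries} {r : ℝ} (hr : 1 < r)
    (hKs : Summable fun b : ℕ →₀ ℕ => ‖MvPowerSeries.coeff b K‖ * r ^ Finsupp.degree b)
    (hKd : DependsOnlyOnLT K M) (x : Fin M → ℝ) (hx : ∀ l, x l ∈ Set.Icc (0:ℝ) 1) (l : Fin M) :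
    (∑' b : ℕ →₀ ℕ, MvPowerSeries.coeff b (relAC (l : ℕ) K) *
        b.prod (fun i e => (fun i : ℕ => if hi : i < M then ((x ⟨i, hi⟩ : ℝ) : ℂ) else 0) i ^ e)).re =
      (∑' a : Fin M →₀ ℕ, (MvPowerSeries.coeff (Finsupp.embDomain Fin.valEmbedding a) K).re *
          ((∏ l' ∈ Finset.univ.erase l, x l' ^ a l') * ((a l : ℝ) * x l ^ (a l - 1)))) -
        (∑' a : Fin M →₀ ℕ, (MvPowerSeries.coeff (Finsupp.embDomain Fin.valEmbedding a) K).re *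
          ∏ l', Function.update x l 1 l' ^ a l') +
        (∑' a : Fin M →₀ ℕ, (MvPowerSeries.coeff (Finsupp.embDomain Fin.valEmbedding a) K).re *
          ∏ l', Function.update x l 0 l' ^ a l') := by
  have hxabs : ∀ l, |x l| ≤ 1 := fun l => abs_le.mpr ⟨by linarith [(hx l).1], (hx l).2⟩
  have hy := norm_cubePt_le_one x hx
  have hK0 : Summable fun b : ℕ →₀ ℕ => ‖MvPowerSeries.coeff b K‖ :=
    summable_norm_coeff_of_hasPolyradiusGtOne ⟨r, hr, hKs⟩
  have hκw := summable_weighted_fin (M := M) hKs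
  have hκ0 : Summable fun a : Fin M →₀ ℕ =>
      ‖MvPowerSeries.coeff (Finsupp.embDomain Fin.valEmbedding a) K‖ :=
    hK0.comp_injective (Finsupp.embDomain_injective (M := ℕ) (Fin.valEmbedding (n := M)))
  -- summability of the three pieces
  have hs1 := summable_coeff_mul_prod_pow hy (summable_norm_coeff_pdz hr hKs (l : ℕ))
  have hs2 := summable_coeff_mul_prod_pow hy (summable_norm_coeff_restrC hK0 (l : ℕ) (c := 1) (by simp))
  have hs3 := summable_coeff_mul_prod_pow hy (summable_norm_coeff_restrC hK0 (l : ℕ) (c := 0) (by simp))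
  -- split the type-(a) image
  have hsplit : ∑' b : ℕ →₀ ℕ, MvPowerSeries.coeff b (relAC (l : ℕ) K) *
      b.prod (fun i e => (fun i : ℕ => if hi : i < M then ((x ⟨i, hi⟩ : ℝ) : ℂ) else 0) i ^ e) =
      (∑' b : ℕ →₀ ℕ, MvPowerSeries.coeff b (pdz (l : ℕ) K) *
        b.prod (fun i e => (fun i : ℕ => if hi : i < M then ((x ⟨i, hi⟩ : ℝ) : ℂ) else 0) i ^ e)) -
      (∑' b : ℕ →₀ ℕ, MvPowerSeries.coeff b (restrC (l : ℕ) 1 K) *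
        b.prod (fun i e => (fun i : ℕ => if hi : i < M then ((x ⟨i, hi⟩ : ℝ) : ℂ) else 0) i ^ e)) +
      (∑' b : ℕ →₀ ℕ, MvPowerSeries.coeff b (restrC (l : ℕ) 0 K) *
        b.prod (fun i e => (fun i : ℕ => if hi : i < M then ((x ⟨i, hi⟩ : ℝ) : ℂ) else 0) i ^ e)) := by
    rw [← hs1.tsum_sub hs2, ← (hs1.sub hs2).tsum_add hs3]
    exact tsum_congr fun b => by rw [coeff_relAC]; ring
  -- the three pieces on the `Fin M` side
  have e1 := tsum_coeff_pdz_eq hKd x l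
  have e2 := tsum_coeff_restrC_eq hKd hK0 x hxabs l 1 (by simp)
  have e3 := tsum_coeff_restrC_eq hKd hK0 x hxabs l 0 (by simp)
  rw [Complex.ofReal_one] at e2
  rw [Complex.ofReal_zero] at e3
  rw [hsplit, e1, e2, e3, Complex.add_re, Complex.sub_re,
    re_tsum_pdzMonomial _ hr hκw x hxabs l,
    re_tsum_monomial _ hκ0 (Function.update x l 1) (fun l' => ?_),
    re_tsum_monomial _ hκ0 (Function.update x l 0) (fun l' => ?_)]
  · rcases eq_or_ne l' l with rfl | h
    · rw [Function.update_self]; simp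
    · rw [Function.update_of_ne h]; exact hxabs l'
  · rcases eq_or_ne l' l with rfl | h
    · rw [Function.update_self]; simp
    · rw [Function.update_of_ne h]; exact hxabs l'

/-- **The identity on the closed unit cube.** If the complex series `F` of the germ (`coeff F = cₐ`
at the exponents pushed from `Fin N`, `0` elsewhere; `Σₐ cₐ xᵃ = h x` on `[0,1]ᴺ`) is
`Σⱼ relAC iⱼ Kⱼ` with `Kⱼ` of polyradius `rⱼ > 1` in the variables `z₀, …, z_{M-1}` (`M ≥ N`, `iⱼ < M`),
then `h(pr x) = Σⱼ (∂gⱼ/∂x_{iⱼ}(x) − gⱼ(x|_{x_{iⱼ}=1}) + gⱼ(x|_{x_{iⱼ}=0}))` on `[0,1]ᴹ`, termwise,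
`gⱼ = Σₐ re(κⱼ a) xᵃ`. [cite: Ayoub2014, Def. 10 and Rem. 13] -/
theorem cube_identity {N J : ℕ} (hNM : N ≤ M) {h : (Fin N → ℝ) → ℝ} {c : (Fin N →₀ ℕ) → ℝ}
    {F : CSeries}
    (hHas : ∀ x ∈ Set.pi Set.univ (fun _ : Fin N => Set.Icc (0:ℝ) 1),
      HasSum (fun a : Fin N →₀ ℕ => c a * ∏ j, x j ^ a j) (h x))
    (hFc : ∀ a : Fin N →₀ ℕ, MvPowerSeries.coeff (a.embDomain Fin.valEmbedding) F = (c a : ℂ))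
    (hFz : ∀ b : ℕ →₀ ℕ, b ∉ Set.range (Finsupp.embDomain (@Fin.valEmbedding N)) →
      MvPowerSeries.coeff b F = 0)
    (K : Fin J → CSeries) (il : Fin J → Fin M) (hF : F = ∑ j, relAC (il j : ℕ) (K j))
    (r : Fin J → ℝ) (hr : ∀ j, 1 < r j)
    (hKs : ∀ j, Summable fun b : ℕ →₀ ℕ => ‖MvPowerSeries.coeff b (K j)‖ * r j ^ Finsupp.degree b)
    (hKd : ∀ j, DependsOnlyOnLT (K j) M)
    (x : Fin M → ℝ) (hx : x ∈ Set.pi Set.univ (fun _ : Fin M => Set.Icc (0:ℝ) 1)) :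
    h (fun l => x (Fin.castLE hNM l)) =
      ∑ j, ((∑' a : Fin M →₀ ℕ, (MvPowerSeries.coeff (Finsupp.embDomain Fin.valEmbedding a) (K j)).re *
              ((∏ l' ∈ Finset.univ.erase (il j), x l' ^ a l') *
                ((a (il j) : ℝ) * x (il j) ^ (a (il j) - 1)))) -
            (∑' a : Fin M →₀ ℕ, (MvPowerSeries.coeff (Finsupp.embDomain Fin.valEmbedding a) (K j)).re *
              ∏ l', Function.update x (il j) 1 l' ^ a l') +
            (∑' a : Fin M →₀ ℕ, (MvPowerSeries.coeff (Finsupp.embDomain Fin.valEmbedding a) (K j)).re *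
              ∏ l', Function.update x (il j) 0 l' ^ a l')) := by
  have hx' : ∀ l, x l ∈ Set.Icc (0:ℝ) 1 := fun l => hx l (Set.mem_univ _)
  have h1 := (hasSum_coeff_mul_prod_pow_castLE hNM hFc hFz x (hHas _ fun l _ => hx' _)).tsum_eq
  rw [hF, tsum_coeff_sum_mul_prod_pow (norm_cubePt_le_one x hx') Finset.univ _
    (fun j _ => summable_norm_coeff_relAC (hr j) (hKs j) _)] at h1
  have h2 := congrArg Complex.re h1
  rw [Complex.ofReal_re, Complex.re_sum] at h2
  exact h2.symm.trans <|
    Finset.sum_congr rfl fun j _ => re_tsum_coeff_relAC (hr j) (hKs j) (hKd j) x hx' (il j)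

end Identity

/-! ## The stub -/

/-- STUB (R) dictionary, folding half: if the complex series `F` of the real germ `Σₐ cₐ xᵃ`
(sum `h` on the closed `N`-cube) lies in the `ℚ̄`-span of type-(a) elements of `𝒪_{ℚ̄-alg}(𝔻̄^∞)`,
then on a closed cube of some dimension `M ≥ N` the pulled-back germ `h ∘ pr` is a finite sum of
REAL type-(a) integrands `∂G/∂xᵢ − G|_{xᵢ=1} + G|_{xᵢ=0}` of functions `G` that are `C¹` and
`ℚ`-semialgebraic on an open neighbourhood of the closed cube, each carried by a closed-cube
representation (take `M` past every variable used; real parts coefficientwise — `relAC` commutes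
with them —; the sum of an `Oan` series is analytic on the open polydisc of radius `> 1` with
termwise partials and restrictions, and is semialgebraic because it is continuous and algebraic
over `ℚ̄(x)` (cell decomposition); the type-(a) integrands are semialgebraic (derivative of a
semialgebraic `C¹` function) and continuous, hence integrable on the cube).
[cite: Ayoub2014, Def. 10 and Rem. 13] -/
theorem stub_spanToReps :
    ∀ (N : ℕ) (h : (Fin N → ℝ) → ℝ) (c : (Fin N →₀ ℕ) → ℝ) (R : ℝ) (F : AyoubRel.CSeries),
      1 < R → Summable (fun a : Fin N →₀ ℕ => |c a| * R ^ a.degree) →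
      (∀ x ∈ Set.pi Set.univ (fun _ : Fin N => Set.Icc (0:ℝ) 1),
        HasSum (fun a : Fin N →₀ ℕ => c a * ∏ j, x j ^ a j) (h x)) →
      (∀ a : Fin N →₀ ℕ, MvPowerSeries.coeff (a.embDomain Fin.valEmbedding) F = (c a : ℂ)) →
      (∀ b : ℕ →₀ ℕ, b ∉ Set.range (Finsupp.embDomain (@Fin.valEmbedding N)) →
        MvPowerSeries.coeff b F = 0) →
      F ∈ AyoubRel.kSpan (algebraMap (algebraicClosure ℚ ℂ) ℂ)
        {x : AyoubRel.CSeries | ∃ G ∈ AyoubRel.Oan (algebraMap (algebraicClosure ℚ ℂ) ℂ),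
          ∃ i : ℕ, x = AyoubRel.relAC i G} →
      ∃ (M : ℕ) (hNM : N ≤ M) (J : ℕ) (i : Fin J → Fin M) (G : Fin J → (Fin M → ℝ) → ℝ)
        (W : Fin J → Set (Fin M → ℝ)) (q : Fin J → IntegralRep M),
        (∀ j, IsOpen (W j) ∧ Set.pi Set.univ (fun _ : Fin M => Set.Icc (0:ℝ) 1) ⊆ W j ∧
          IsSemialgebraicFunOn ℚ (W j) (G j) ∧ ContDiffOn ℝ 1 (G j) (W j)) ∧
        (∀ j, (q j).domain = Set.pi Set.univ (fun _ : Fin M => Set.Icc (0:ℝ) 1) ∧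
          ∀ x ∈ (q j).domain, (q j).integrand x =
            fderiv ℝ (G j) x (Pi.single (i j) 1) - G j (Function.update x (i j) 1) +
              G j (Function.update x (i j) 0)) ∧
        ∀ x ∈ Set.pi Set.univ (fun _ : Fin M => Set.Icc (0:ℝ) 1),
          h (fun l => x (Fin.castLE hNM l)) = ∑ j, (q j).integrand x := by
  intro N h c R F _ _ hHas hFc hFz hspan
  classical
  obtain ⟨J, lam, s, hs, hF⟩ := hspan
  choose G hG i hsi using hs
  -- `Kⱼ = λⱼ Gⱼ ∈ 𝒪_{ℚ̄-alg}(𝔻̄^∞)`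
  have hlam : ∀ j, ∃ p : Polynomial (algebraicClosure ℚ ℂ), p ≠ 0 ∧
      Polynomial.eval₂ (algebraMap (algebraicClosure ℚ ℂ) ℂ)
        (algebraMap (algebraicClosure ℚ ℂ) ℂ (lam j)) p = 0 := fun j =>
    ⟨Polynomial.X - Polynomial.C (lam j), Polynomial.X_sub_C_ne_zero _, by simp⟩
  have hK : ∀ j, (algebraMap (algebraicClosure ℚ ℂ) ℂ (lam j)) • G j ∈
      Oan (algebraMap (algebraicClosure ℚ ℂ) ℂ) := fun j => smul_mem_Oan _ (hlam j) (hG j)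
  choose m hm using fun j => (hK j).1
  choose r hr1 hrs using fun j => (hK j).2.1
  choose P hP0 hPK using fun j => exists_rat_polynomial_smul (hG j).2.2 (lam j)
  choose V hV using fun j => exists_vars_subset_range (P j)
  -- the dimension `M`
  obtain ⟨M, hNM, hiM, hmM, hVM⟩ : ∃ M, N ≤ M ∧ (∀ j, i j < M) ∧ (∀ j, m j ≤ M) ∧ ∀ j, V j ≤ M := by
    refine ⟨N + ∑ j, (i j + m j + V j + 1), Nat.le_add_right _ _, fun j => ?_, fun j => ?_, fun j => ?_⟩
    all_goals
      have hle : i j + m j + V j + 1 ≤ ∑ j', (i j' + m j' + V j' + 1) :=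
        Finset.single_le_sum (f := fun j' => i j' + m j' + V j' + 1) (fun _ _ => Nat.zero_le _)
          (Finset.mem_univ j)
      omega
  have hKd : ∀ j, DependsOnlyOnLT ((algebraMap (algebraicClosure ℚ ℂ) ℂ (lam j)) • G j) M :=
    fun j => (hm j).mono (hmM j)
  have hvars : ∀ j n, (↑((P j).coeff n).vars : Set ℕ) ⊆ Set.range (Fin.val : Fin M → ℕ) :=
    fun j n => hV j M (hVM j) n
  -- one package per generator
  choose ρ hρ1 hρr hsemi hC1 hderiv using
    fun j => generator_package (hr1 j) (hrs j) (hKd j) (hP0 j) (hPK j) (hvars j)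
  -- the data
  set il : Fin J → Fin M := fun j => ⟨i j, hiM j⟩ with hil
  set gfun : Fin J → (Fin M → ℝ) → ℝ := fun j y => ∑' a : Fin M →₀ ℕ,
    (MvPowerSeries.coeff (Finsupp.embDomain Fin.valEmbedding a)
      ((algebraMap (algebraicClosure ℚ ℂ) ℂ (lam j)) • G j)).re * ∏ l, y l ^ a l with hgfun
  have hWo : ∀ j, IsOpen (Set.pi Set.univ (fun _ : Fin M => Set.Ioo (-(ρ j : ℝ)) (ρ j))) :=
    fun j => isOpen_box _
  have hcubeW : ∀ j, Set.pi Set.univ (fun _ : Fin M => Set.Icc (0:ℝ) 1) ⊆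
      Set.pi Set.univ (fun _ : Fin M => Set.Ioo (-(ρ j : ℝ)) (ρ j)) := fun j => cubePi_subset_box (hρ1 j)
  -- the integrands: semialgebraic and continuous on the closed cube
  have hupd : ∀ j (t : ℚ), (t : ℝ) ∈ Set.Icc (0:ℝ) 1 →
      IsSemialgebraicFunOn ℚ (Set.pi Set.univ (fun _ : Fin M => Set.Icc (0:ℝ) 1))
          (fun x => gfun j (Function.update x (il j) (t : ℝ))) ∧
        ContinuousOn (fun x => gfun j (Function.update x (il j) (t : ℝ)))
          (Set.pi Set.univ (fun _ : Fin M => Set.Icc (0:ℝ) 1)) := by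
    intro j t ht
    have hmaps : MapsTo (fun x : Fin M → ℝ => Function.update x (il j) (t : ℝ))
        (Set.pi Set.univ (fun _ : Fin M => Set.Icc (0:ℝ) 1))
        (Set.pi Set.univ (fun _ : Fin M => Set.Ioo (-(ρ j : ℝ)) (ρ j))) := by
      intro x hx
      refine hcubeW j fun l _ => ?_
      show Function.update x (il j) (t : ℝ) l ∈ Set.Icc (0:ℝ) 1
      rcases eq_or_ne l (il j) with rfl | hl
      · rw [Function.update_self]; exact ht
      · rw [Function.update_of_ne hl]; exact hx l (mem_univ _)
    exact ⟨IsSemialgebraicFunOn.comp_isSemialgebraicMapOn_holds (hsemi j)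
        (isSemialgebraicMapOn_update (il j) t) hmaps,
      (hC1 j).continuousOn.comp (continuous_id.update (il j) continuous_const).continuousOn hmaps⟩
  have hint : ∀ j, IsSemialgebraicFunOn ℚ (Set.pi Set.univ (fun _ : Fin M => Set.Icc (0:ℝ) 1))
        (fun x => fderiv ℝ (gfun j) x (Pi.single (il j) 1) - gfun j (Function.update x (il j) 1) +
          gfun j (Function.update x (il j) 0)) ∧
      ContinuousOn (fun x => fderiv ℝ (gfun j) x (Pi.single (il j) 1) -
          gfun j (Function.update x (il j) 1) + gfun j (Function.update x (il j) 0))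
        (Set.pi Set.univ (fun _ : Fin M => Set.Icc (0:ℝ) 1)) := by
    intro j
    have h1 := hupd j 1 (by simp)
    have h0 := hupd j 0 (by simp)
    simp only [Rat.cast_one, Rat.cast_zero] at h1 h0
    have hd : IsSemialgebraicFunOn ℚ (Set.pi Set.univ (fun _ : Fin M => Set.Icc (0:ℝ) 1))
        (fun x => fderiv ℝ (gfun j) x (Pi.single (il j) 1)) :=
      (IsSemialgebraicFunOn.fderiv_apply_single (hWo j) (hsemi j)
        (fun x hx => ((hC1 j).differentiableOn one_ne_zero x hx).differentiableAt
          ((hWo j).mem_nhds hx))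
        (il j)).mono (hcubeW j) (isSemialgebraic_cubePi M)
    have hdc : ContinuousOn (fun x => fderiv ℝ (gfun j) x (Pi.single (il j) 1))
        (Set.pi Set.univ (fun _ : Fin M => Set.Icc (0:ℝ) 1)) :=
      (((hC1 j).continuousOn_fderiv_of_isOpen (hWo j) le_rfl).mono (hcubeW j)).clm_apply
        continuousOn_const
    exact ⟨(hd.fun_sub h1.1).fun_add h0.1, (hdc.sub h1.2).add h0.2⟩
  -- the closed-cube representations
  have hq : ∀ j, ∃ q : IntegralRep M, q.domain = Set.pi Set.univ (fun _ : Fin M => Set.Icc (0:ℝ) 1) ∧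
      q.integrand = fun x => fderiv ℝ (gfun j) x (Pi.single (il j) 1) -
        gfun j (Function.update x (il j) 1) + gfun j (Function.update x (il j) 0) := fun j =>
    ⟨{ domain := Set.pi Set.univ (fun _ : Fin M => Set.Icc (0:ℝ) 1)
       integrand := fun x => fderiv ℝ (gfun j) x (Pi.single (il j) 1) -
         gfun j (Function.update x (il j) 1) + gfun j (Function.update x (il j) 0)
       isSemialgebraic_domain := isSemialgebraic_cubePi M
       isSemialgebraicFunOn_integrand := (hint j).1
       integrableOn := (hint j).2.integrableOn_compact (isCompact_univ_pi fun _ => isCompact_Icc) },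
      rfl, rfl⟩
  choose q hqd hqi using hq
  refine ⟨M, hNM, J, il, gfun, fun j => Set.pi Set.univ (fun _ : Fin M => Set.Ioo (-(ρ j : ℝ)) (ρ j)),
    q, fun j => ⟨hWo j, hcubeW j, hsemi j, hC1 j⟩, fun j => ⟨hqd j, fun x _ => by rw [hqi j]⟩,
    fun x hx => ?_⟩
  -- the identity on the closed cube
  have hF' : F = ∑ j, relAC (il j : ℕ) ((algebraMap (algebraicClosure ℚ ℂ) ℂ (lam j)) • G j) := by
    rw [hF]
    exact Finset.sum_congr rfl fun j _ => by rw [hsi j, relAC_smul]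
  rw [cube_identity hNM hHas hFc hFz _ il hF' r hr1 hrs hKd x hx]
  refine Finset.sum_congr rfl fun j _ => ?_
  rw [hqi j]
  simp only [hgfun]
  rw [hderiv j x (hcubeW j hx) (il j)]

end Summit.KontsevichZagierPeriods.KontsevichZagierPeriods.StokesGenerationLine
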